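import Summits.RiemannHypothesis.RiemannHypothesis.Theorems.WeilCombCombShapePositivityMertensSmall
import HarnessLib

/-!
# `∑_{n ≤ N} Λ(n)/n ≤ log N − γ + 9/100` for the integers `20 ≤ N ≤ 318` (stub, plan A4)

Summit `RiemannHypothesis`, crux `WeilComb.CombShapePositivity` (item stmt-RiemannHypothesis-11229),
line `Sketch`, plan item A4 ("small range table", integer form on `[20, 318]`): the registered stub
`stub_psiOneSmallRange` of the skeleton namespace `…Theorems.WeilCombBohrFejer`.

The statement is already in the tree, with explicit binders, as
`Summit.RiemannHypothesis.RiemannHypothesis.Theorems.WeilCombMertensSmall.sum_vonMangoldt_div_le_small_nat`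
(`Theorems/WeilCombCombShapePositivityMertensSmall.lean`: a `2⁸⁰`-fixed-point walk over
`n = 1, …, 318` with the kernel logarithm enclosures of `Literature/Analysis/SpecialFunctions/KernelLog`
and the `γ` enclosure of `Literature/Analysis/SpecialFunctions/EulerMascheroniBounds`, checked by
the kernel). This file only re-exports it in the registered `∀`-form; nothing else is proved here.
Numerically the maximum of `∑_{n ≤ N} Λ(n)/n − log N + γ` on `20 ≤ N ≤ 318` is `0.0864…` (at
`N = 31`), and the bound fails at `N = 19` (`0.1076…`).
-/

set_option linter.dupNamespace false -- the sub-problem path RiemannHypothesis/RiemannHypothesis duplicates a namespace (D-0017)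

namespace Summit.RiemannHypothesis.RiemannHypothesis.Theorems.WeilCombBohrFejer

/-- **Small-range table (plan A4, integer form).** For every integer `20 ≤ N ≤ 318`,
`∑_{n ≤ N} Λ(n)/n ≤ log N − γ + 9/100` (the tree's kernel-checked table
`WeilCombMertensSmall.sum_vonMangoldt_div_le_small_nat`, restated with the registered binders).
[folklore] -/
theorem stub_psiOneSmallRange : ∀ N : ℕ, 20 ≤ N → N ≤ 318 → (∑ n ∈ Finset.Icc 1 N, (ArithmeticFunction.vonMangoldt n : ℝ) / n) ≤ Real.log N - Real.eulerMascheroniConstant + 9 / 100 :=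
  fun _ h20 h318 => WeilCombMertensSmall.sum_vonMangoldt_div_le_small_nat h20 h318

end Summit.RiemannHypothesis.RiemannHypothesis.Theorems.WeilCombBohrFejer
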